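import Literature.Probability.LatticeModels.PolymerPressure

/-!
# Crux `AnchorGap` (stmt-QuantumFields-11141), line `registered` — stub KP: the generic Kotecký–Preiss covariance step

The abstract cluster-expansion bookkeeping behind exponential clustering of two dressed partition
functions (the model-independent half of the Debye-screening stub `X₀` of the skeleton
`Cruxes/AnchorGap/Lines/birth.lean`; abstracted from
`Literature.MathematicalPhysics.QuantumFieldTheory.LatticeForm.KPRegime.norm_closedCov_le`).

Setting: a finite polymer type `P` with a reflexive symmetric incompatibility `inc`, size functions
`a, d ≥ 0`, a finite volume `Λ`, two "support" polymers `σ₁, σ₂` and four activity systems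
`w₁, w_F, w_G, w_FG : P → ℂ` (undressed / dressed by a first observable / by a second / by both),
each satisfying the Kotecký–Preiss condition (1) `∑_{γ' ι γ} |w γ'| e^{a γ' + d γ'} ≤ a γ`, and
LOCAL: a polymer compatible with `σ₁` does not see the first dressing (`w_F = w₁`, `w_FG = w_G`
there), a polymer compatible with `σ₂` does not see the second.

* `stub_kpDressedClustering` — if every cluster `C ⊆ Λ` touching both `σ₂` and `σ₁` has
  `∑_{X ∈ C} d X ≥ D`, then `Ξ(w₁), Ξ(w_F), Ξ(w_G) ≠ 0` and
  `‖Ξ(w_FG)/Ξ(w₁) − (Ξ(w_F)/Ξ(w₁))(Ξ(w_G)/Ξ(w₁))‖ ≤ 6 a(σ₁) e^{6a(σ₁)+2a(σ₂)} e^{−D}`.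

Proof ([KP86, Theorem p. 492]): zero-freeness and `Ξ(w) = exp ∑_{C ⊆ Λ} Φ^T_w(C)` ((2) and the
KP logarithm), so `Ξ(w)/Ξ(w₁) = exp ∑_C (Φ^T_w − Φ^T_{w₁})(C)`; by locality and
`truncatedWeight_congr` the difference vanishes on families not touching the relevant support;
splitting the cluster sum according to which supports are touched gives
`Cov = e^{A₁+A₂}(e^{R₁₂} − e^{R₁+R₂})` with `|A_i| ≤ 2 a(σ_i)` (estimate (4),
`sum_norm_truncatedWeight_le_of_touches`) and `|R| ≤ 2 e^{−D} a(σ₁)` (estimate (4) with the decay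
`d`, `sum_norm_truncatedWeight_le_exp_neg_of_touches`, non-clusters contributing nothing by
`truncatedWeight_eq_zero_of_kp`); the KP estimate (4) itself is the proved
`koteckyPreiss_truncatedWeight_bound_holds`.
-/

set_option autoImplicit false

noncomputable section

namespace Summit.QuantumFields.YangMills.Theorems.AnchorGap

open Finset
open Literature.Probability.LatticeModels

/-- `‖e^z - 1‖ ≤ ‖z‖ e^{‖z‖}`. [folklore] -/
private lemma kp_norm_exp_sub_one_le (z : ℂ) : ‖Complex.exp z - 1‖ ≤ ‖z‖ * Real.exp ‖z‖ := by
  have h := Complex.norm_exp_sub_sum_le_norm_mul_exp z 1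
  simpa using h

/-- Norm of an indicator-weighted sum. [folklore] -/
private lemma kp_norm_sum_ite_le {ι : Type*} (s : Finset ι) (p : ι → Prop) [DecidablePred p]
    (f : ι → ℂ) :
    ‖∑ i ∈ s, (if p i then f i else 0)‖ ≤ ∑ i ∈ s, (if p i then ‖f i‖ else 0) := by
  refine (norm_sum_le _ _).trans (Finset.sum_le_sum fun i _ => ?_)
  split_ifs <;> simp

section KPHelpers

variable {P : Type} [Fintype P] [DecidableEq P] {inc : P → P → Prop} [DecidableRel inc]
  [Std.Refl inc] [Std.Symm inc] {a d : P → ℝ}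

omit [DecidableEq P] [Std.Refl inc] [Std.Symm inc] in
/-- The finite Kotecký–Preiss hypothesis (1) (with `d ≥ 0`) gives the finite-volume KP condition
on every volume. [cite: KoteckyPreiss1986, (1)] -/
private lemma kp_isKPVolume (hd : ∀ γ : P, 0 ≤ d γ) {w : P → ℂ}
    (h : ∀ γ : P, ∑ γ' ∈ Finset.univ.filter (fun γ' => inc γ' γ),
      ‖w γ'‖ * Real.exp (a γ' + d γ') ≤ a γ)
    (Λ : Finset P) : IsKPVolume inc w a Λ :=
  isKPVolume_of_tsum_le hd (kp_hypothesis_of_fintype h) Λ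

/-- `Ξ_Λ(w) = exp (∑_{C ⊆ Λ} Φ^T_w(C))` under the KP condition (the KP logarithm and the
expansion (2)). [cite: KoteckyPreiss1986, Theorem p. 492 with (2)] -/
private lemma kp_ppf_eq_exp (hd : ∀ γ : P, 0 ≤ d γ) {w : P → ℂ}
    (h : ∀ γ : P, ∑ γ' ∈ Finset.univ.filter (fun γ' => inc γ' γ),
      ‖w γ'‖ * Real.exp (a γ' + d γ') ≤ a γ)
    (Λ : Finset P) :
    polymerPartitionFunction inc w Λ =
      Complex.exp (∑ C ∈ Λ.powerset, truncatedWeight inc w C) := by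
  rw [← polymerLogZ_eq_sum_truncatedWeight,
    exp_polymerLogZ_of_kp (kp_isKPVolume hd h Λ) (Finset.Subset.refl Λ)]

/-- Estimate (4) at the polymer `σ`: the families touching `σ` have total truncated weight at
most `a σ`. [cite: KoteckyPreiss1986, Theorem p. 492, estimate (4)] -/
private lemma kp_sum_ite_touches_le (ha : ∀ γ : P, 0 ≤ a γ) (hd : ∀ γ : P, 0 ≤ d γ) {w : P → ℂ}
    (h : ∀ γ : P, ∑ γ' ∈ Finset.univ.filter (fun γ' => inc γ' γ),
      ‖w γ'‖ * Real.exp (a γ' + d γ') ≤ a γ)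
    (𝒞 : Finset (Finset P)) (σ : P) [DecidablePred fun C : Finset P => KPTouches inc C σ] :
    ∑ C ∈ 𝒞, (if KPTouches inc C σ then ‖truncatedWeight inc w C‖ else 0) ≤ a σ := by
  rw [← Finset.sum_filter]
  exact sum_norm_truncatedWeight_le_of_touches
    (koteckyPreiss_truncatedWeight_bound_holds inc w a d) ha hd (kp_hypothesis_of_fintype h) 𝒞 σ

/-- Estimate (4) with the decay `d`: the families in `Λ` touching both `σ₁` and `σ₂` have total
truncated weight at most `e^{-D} a σ₁` when every such cluster has `∑ d ≥ D` (non-clusters do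
not contribute). [cite: KoteckyPreiss1986, Theorem p. 492, estimate (4) and last assertion] -/
private lemma kp_sum_ite_both_le (ha : ∀ γ : P, 0 ≤ a γ) (hd : ∀ γ : P, 0 ≤ d γ) {w : P → ℂ}
    (h : ∀ γ : P, ∑ γ' ∈ Finset.univ.filter (fun γ' => inc γ' γ),
      ‖w γ'‖ * Real.exp (a γ' + d γ') ≤ a γ)
    (Λ : Finset P) (σ₁ σ₂ : P) [DecidablePred fun C : Finset P => KPTouches inc C σ₁]
    [DecidablePred fun C : Finset P => KPTouches inc C σ₂] {D : ℝ}
    (hD : ∀ C ∈ Λ.powerset, IsPolymerCluster inc C → KPTouches inc C σ₂ → KPTouches inc C σ₁ →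
      D ≤ ∑ X ∈ C, d X) :
    ∑ C ∈ Λ.powerset, (if KPTouches inc C σ₁ ∧ KPTouches inc C σ₂ then
        ‖truncatedWeight inc w C‖ else 0) ≤ Real.exp (-D) * a σ₁ := by
  classical
  have hfar := sum_norm_truncatedWeight_le_exp_neg_of_touches
    (koteckyPreiss_truncatedWeight_bound_holds inc w a d) ha hd (kp_hypothesis_of_fintype h)
    (Λ.powerset.filter fun C => IsPolymerCluster inc C ∧ KPTouches inc C σ₂) σ₁ (r := D)
    (fun C hC ht => by
      rw [Finset.mem_filter] at hC
      exact hD C hC.1 hC.2.1 hC.2.2 ht)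
  refine le_trans ?_ hfar
  calc ∑ C ∈ Λ.powerset, (if KPTouches inc C σ₁ ∧ KPTouches inc C σ₂ then
          ‖truncatedWeight inc w C‖ else 0)
      = ∑ C ∈ Λ.powerset, (if IsPolymerCluster inc C ∧ KPTouches inc C σ₂ then
          (if KPTouches inc C σ₁ then
            (if KPTouches inc C σ₁ ∧ KPTouches inc C σ₂ then ‖truncatedWeight inc w C‖ else 0)
            else 0) else 0) := by
        refine Finset.sum_congr rfl fun C hC => ?_
        by_cases hcl : IsPolymerCluster inc C
        · by_cases h1 : KPTouches inc C σ₁ <;> by_cases h2 : KPTouches inc C σ₂ <;>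
            simp [hcl, h1, h2]
        · have hT0 : truncatedWeight inc w C = 0 :=
            truncatedWeight_eq_zero_of_kp (kp_isKPVolume hd h Λ) (Finset.mem_powerset.1 hC) hcl
          simp [hcl, hT0]
    _ = ∑ C ∈ (Λ.powerset.filter fun C => IsPolymerCluster inc C ∧ KPTouches inc C σ₂).filter
          (fun C => KPTouches inc C σ₁),
          (if KPTouches inc C σ₁ ∧ KPTouches inc C σ₂ then ‖truncatedWeight inc w C‖ else 0) := by
        rw [Finset.sum_filter, Finset.sum_filter]
    _ ≤ ∑ C ∈ (Λ.powerset.filter fun C => IsPolymerCluster inc C ∧ KPTouches inc C σ₂).filter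
          (fun C => KPTouches inc C σ₁), ‖truncatedWeight inc w C‖ :=
        Finset.sum_le_sum fun C _ => by split_ifs <;> simp

/-- Norm of a cluster sum of activity differences supported on families touching `σ`:
`‖∑ 1_p (Φ^T_w − Φ^T_{w₁})‖ ≤ 2 a σ`. [cite: KoteckyPreiss1986, Theorem p. 492, estimate (4)] -/
private lemma kp_norm_sum_ite_sub_le (ha : ∀ γ : P, 0 ≤ a γ) (hd : ∀ γ : P, 0 ≤ d γ)
    {w₁ w : P → ℂ}
    (h₁ : ∀ γ : P, ∑ γ' ∈ Finset.univ.filter (fun γ' => inc γ' γ),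
      ‖w₁ γ'‖ * Real.exp (a γ' + d γ') ≤ a γ)
    (h : ∀ γ : P, ∑ γ' ∈ Finset.univ.filter (fun γ' => inc γ' γ),
      ‖w γ'‖ * Real.exp (a γ' + d γ') ≤ a γ)
    (𝒞 : Finset (Finset P)) (σ : P) [DecidablePred fun C : Finset P => KPTouches inc C σ]
    (p : Finset P → Prop) [DecidablePred p] (hp : ∀ C, p C → KPTouches inc C σ) :
    ‖∑ C ∈ 𝒞, (if p C then truncatedWeight inc w C - truncatedWeight inc w₁ C else 0)‖ ≤
      2 * a σ := by
  refine (kp_norm_sum_ite_le 𝒞 p _).trans ?_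
  have e1 := kp_sum_ite_touches_le ha hd h 𝒞 σ
  have e2 := kp_sum_ite_touches_le ha hd h₁ 𝒞 σ
  calc ∑ C ∈ 𝒞, (if p C then ‖truncatedWeight inc w C - truncatedWeight inc w₁ C‖ else 0)
      ≤ ∑ C ∈ 𝒞, ((if KPTouches inc C σ then ‖truncatedWeight inc w C‖ else 0) +
          (if KPTouches inc C σ then ‖truncatedWeight inc w₁ C‖ else 0)) :=
        Finset.sum_le_sum fun C _ => by
          by_cases hpC : p C
          · have hm := hp C hpC
            simp only [hpC, hm, if_true]
            exact norm_sub_le _ _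
          · simp only [hpC, if_false]
            positivity
    _ ≤ 2 * a σ := by rw [Finset.sum_add_distrib]; linarith

/-- Norm of the cluster sum of activity differences over families touching both supports:
`≤ 2 e^{-D} a σ₁`. [cite: KoteckyPreiss1986, Theorem p. 492, estimate (4)] -/
private lemma kp_norm_sum_ite_both_sub_le (ha : ∀ γ : P, 0 ≤ a γ) (hd : ∀ γ : P, 0 ≤ d γ)
    {w₁ w : P → ℂ}
    (h₁ : ∀ γ : P, ∑ γ' ∈ Finset.univ.filter (fun γ' => inc γ' γ),
      ‖w₁ γ'‖ * Real.exp (a γ' + d γ') ≤ a γ)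
    (h : ∀ γ : P, ∑ γ' ∈ Finset.univ.filter (fun γ' => inc γ' γ),
      ‖w γ'‖ * Real.exp (a γ' + d γ') ≤ a γ)
    (Λ : Finset P) (σ₁ σ₂ : P) [DecidablePred fun C : Finset P => KPTouches inc C σ₁]
    [DecidablePred fun C : Finset P => KPTouches inc C σ₂] {D : ℝ}
    (hD : ∀ C ∈ Λ.powerset, IsPolymerCluster inc C → KPTouches inc C σ₂ → KPTouches inc C σ₁ →
      D ≤ ∑ X ∈ C, d X) :
    ‖∑ C ∈ Λ.powerset, (if KPTouches inc C σ₁ ∧ KPTouches inc C σ₂ then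
        truncatedWeight inc w C - truncatedWeight inc w₁ C else 0)‖ ≤ 2 * (Real.exp (-D) * a σ₁) := by
  refine (kp_norm_sum_ite_le _ _ _).trans ?_
  have e1 := kp_sum_ite_both_le ha hd h Λ σ₁ σ₂ hD
  have e2 := kp_sum_ite_both_le ha hd h₁ Λ σ₁ σ₂ hD
  calc ∑ C ∈ Λ.powerset, (if KPTouches inc C σ₁ ∧ KPTouches inc C σ₂ then
          ‖truncatedWeight inc w C - truncatedWeight inc w₁ C‖ else 0)
      ≤ ∑ C ∈ Λ.powerset,
          ((if KPTouches inc C σ₁ ∧ KPTouches inc C σ₂ then ‖truncatedWeight inc w C‖ else 0) +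
          (if KPTouches inc C σ₁ ∧ KPTouches inc C σ₂ then ‖truncatedWeight inc w₁ C‖ else 0)) :=
        Finset.sum_le_sum fun C _ => by
          split_ifs
          · exact norm_sub_le _ _
          · simp
    _ ≤ 2 * (Real.exp (-D) * a σ₁) := by rw [Finset.sum_add_distrib]; linarith

end KPHelpers

/-- **Stub KP (GENERIC — the Kotecký–Preiss covariance step, abstracted from
`LatticeForm.KPRegime.norm_closedCov_le`).** Let `inc` be a reflexive symmetric incompatibility on a
finite polymer type `P`, `a, d ≥ 0` size functions, `Λ` a finite volume, `σ₁, σ₂` two "support"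
polymers and `w₁, w_F, w_G, w_FG` four activity systems (undressed / dressed by the first
observable / by the second / by both), each obeying the Kotecký–Preiss condition
`Σ_{γ' ι γ} |w γ'| e^{a γ' + d γ'} ≤ a γ`, and LOCAL: a polymer compatible with `σ₁` does not see
the first dressing, a polymer compatible with `σ₂` does not see the second.  If every cluster in `Λ`
touching both `σ₂` and `σ₁` has `Σ d ≥ D`, then the three partition functions `Ξ(w₁), Ξ(w_F),
Ξ(w_G)` are non-zero and
`‖Ξ(w_FG)/Ξ(w₁) − (Ξ(w_F)/Ξ(w₁))(Ξ(w_G)/Ξ(w₁))‖ ≤ 6 a(σ₁) e^{6a(σ₁)+2a(σ₂)} e^{−D}`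
(`Ξ(w)/Ξ(w₁) = exp Σ_{C touches support} (Φ^T_w − Φ^T_{w₁})(C)` by `exp_polymerLogZ_of_kp` +
`polymerLogZ_eq_sum_truncatedWeight` + `truncatedWeight_congr`; clusters touching one support by
estimate (4) `sum_norm_truncatedWeight_le_of_touches`; clusters touching both by
`sum_norm_truncatedWeight_le_exp_neg_of_touches`; `Cov = e^{A₁+A₂}(e^{R₁₂} − e^{R₁+R₂})`).
[cite: KoteckyPreiss1986, Theorem p. 492, (2), (4), (5)] -/
theorem stub_kpDressedClustering : ∀ (P : Type) [Fintype P] [DecidableEq P] (inc : P → P → Prop) [DecidableRel inc] [Std.Refl inc] [Std.Symm inc] (a d : P → ℝ), (∀ γ : P, 0 ≤ a γ) → (∀ γ : P, 0 ≤ d γ) → ∀ (Λ : Finset P) (σ₁ σ₂ : P) (w₁ wF wG wFG : P → ℂ), (∀ γ : P, ∑ γ' ∈ Finset.univ.filter (fun γ' => inc γ' γ), ‖w₁ γ'‖ * Real.exp (a γ' + d γ') ≤ a γ) → (∀ γ : P, ∑ γ' ∈ Finset.univ.filter (fun γ' => inc γ' γ), ‖wF γ'‖ * Real.exp (a γ'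 + d γ') ≤ a γ) → (∀ γ : P, ∑ γ' ∈ Finset.univ.filter (fun γ' => inc γ' γ), ‖wG γ'‖ * Real.exp (a γ' + d γ') ≤ a γ) → (∀ γ : P, ∑ γ' ∈ Finset.univ.filter (fun γ' => inc γ' γ), ‖wFG γ'‖ * Real.exp (a γ' + d γ') ≤ a γ) → (∀ X : P, ¬ inc X σ₁ → wF X = w₁ X ∧ wFG X = wG X) → (∀ X : P, ¬ inc X σ₂ → wG X = w₁ X ∧ wFG X = wF X) → ∀ D : ℝ, 0 ≤ D → (∀ C ∈ Λ.powerset, IsPolymerCluster inc C → KPTouches inc C σ₂ → KPTouches inc C σ₁ → D ≤ ∑ X ∈ C, d X) → polymerPartitionFunction inc w₁ Λ ≠ 0 ∧ polymerPartitionFunction inc wF Λ ≠ 0 ∧ polymerPartitionFunction inc wG Λ ≠ 0 ∧ ‖polymerPartitionFunction inc wFG Λ / polymerPartitionFunction inc w₁ Λ - (polymerPartitionFunction inc wF Λ / polymerPartitionFunction inc w₁ Λ) * (polymerPartitionFunction inc wG Λ / polymerPartitionFunction inc w₁ Λ)‖ ≤ 6 * a σ₁ * Real.exp (6 * a σ₁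 + 2 * a σ₂) * Real.exp (-D) := by
  intro P _ _ inc _ _ _ a d ha hd Λ σ₁ σ₂ w₁ wF wG wFG h₁ hF hG hFG hloc₁ hloc₂ D hD0 hD
  classical
  have hne : ∀ {w : P → ℂ}, (∀ γ : P, ∑ γ' ∈ Finset.univ.filter (fun γ' => inc γ' γ),
      ‖w γ'‖ * Real.exp (a γ' + d γ') ≤ a γ) → polymerPartitionFunction inc w Λ ≠ 0 :=
    fun h => polymerPartitionFunction_ne_zero_of_kp (kp_isKPVolume hd h Λ) (Finset.Subset.refl Λ)
  refine ⟨hne h₁, hne hF, hne hG, ?_⟩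
  -- the ratios `Ξ(w)/Ξ(w₁)` through clusters
  have hratio : ∀ {w : P → ℂ}, (∀ γ : P, ∑ γ' ∈ Finset.univ.filter (fun γ' => inc γ' γ),
      ‖w γ'‖ * Real.exp (a γ' + d γ') ≤ a γ) →
      polymerPartitionFunction inc w Λ / polymerPartitionFunction inc w₁ Λ =
        Complex.exp (∑ C ∈ Λ.powerset, (truncatedWeight inc w C - truncatedWeight inc w₁ C)) := by
    intro w h
    rw [kp_ppf_eq_exp hd h Λ, kp_ppf_eq_exp hd h₁ Λ, ← Complex.exp_sub, ← Finset.sum_sub_distrib]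
  -- locality: the differences of truncated functionals vanish off the supports
  have hcongr : ∀ {w w' : P → ℂ} {σ : P} (C : Finset P), (∀ X : P, ¬ inc X σ → w X = w' X) →
      ¬ KPTouches inc C σ → truncatedWeight inc w C = truncatedWeight inc w' C := by
    intro w w' σ C hw hC
    exact truncatedWeight_congr fun X hX => hw X fun hXσ => hC ⟨X, hX, hXσ⟩
  have hv₁ : ∀ C, ¬ KPTouches inc C σ₁ →
      truncatedWeight inc wF C - truncatedWeight inc w₁ C = 0 :=
    fun C hC => by rw [hcongr C (fun X hX => (hloc₁ X hX).1) hC, sub_self]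
  have hv₂ : ∀ C, ¬ KPTouches inc C σ₂ →
      truncatedWeight inc wG C - truncatedWeight inc w₁ C = 0 :=
    fun C hC => by rw [hcongr C (fun X hX => (hloc₂ X hX).1) hC, sub_self]
  have hv₁₂₁ : ∀ C, ¬ KPTouches inc C σ₂ →
      truncatedWeight inc wFG C - truncatedWeight inc w₁ C =
        truncatedWeight inc wF C - truncatedWeight inc w₁ C :=
    fun C hC => by rw [hcongr C (fun X hX => (hloc₂ X hX).2) hC]
  have hv₁₂₂ : ∀ C, ¬ KPTouches inc C σ₁ →
      truncatedWeight inc wFG C - truncatedWeight inc w₁ C =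
        truncatedWeight inc wG C - truncatedWeight inc w₁ C :=
    fun C hC => by rw [hcongr C (fun X hX => (hloc₁ X hX).2) hC]
  have hv₁₂₀ : ∀ C, ¬ KPTouches inc C σ₁ → ¬ KPTouches inc C σ₂ →
      truncatedWeight inc wFG C - truncatedWeight inc w₁ C = 0 :=
    fun C h1 h2 => by rw [hv₁₂₂ C h1, hv₂ C h2]
  -- bounds on the exponents (estimate (4))
  have hA₁b : ‖∑ C ∈ Λ.powerset, (if KPTouches inc C σ₁ ∧ ¬ KPTouches inc C σ₂ then
      truncatedWeight inc wF C - truncatedWeight inc w₁ C else 0)‖ ≤ 2 * a σ₁ :=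
    kp_norm_sum_ite_sub_le ha hd h₁ hF Λ.powerset σ₁
      (fun C => KPTouches inc C σ₁ ∧ ¬ KPTouches inc C σ₂) (fun C hC => hC.1)
  have hA₂b : ‖∑ C ∈ Λ.powerset, (if KPTouches inc C σ₂ ∧ ¬ KPTouches inc C σ₁ then
      truncatedWeight inc wG C - truncatedWeight inc w₁ C else 0)‖ ≤ 2 * a σ₂ :=
    kp_norm_sum_ite_sub_le ha hd h₁ hG Λ.powerset σ₂
      (fun C => KPTouches inc C σ₂ ∧ ¬ KPTouches inc C σ₁) (fun C hC => hC.1)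
  have hR₁b : ‖∑ C ∈ Λ.powerset, (if KPTouches inc C σ₁ ∧ KPTouches inc C σ₂ then
      truncatedWeight inc wF C - truncatedWeight inc w₁ C else 0)‖ ≤ 2 * (Real.exp (-D) * a σ₁) :=
    kp_norm_sum_ite_both_sub_le ha hd h₁ hF Λ σ₁ σ₂ hD
  have hR₂b : ‖∑ C ∈ Λ.powerset, (if KPTouches inc C σ₁ ∧ KPTouches inc C σ₂ then
      truncatedWeight inc wG C - truncatedWeight inc w₁ C else 0)‖ ≤ 2 * (Real.exp (-D) * a σ₁) :=
    kp_norm_sum_ite_both_sub_le ha hd h₁ hG Λ σ₁ σ₂ hD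
  have hR₁₂b : ‖∑ C ∈ Λ.powerset, (if KPTouches inc C σ₁ ∧ KPTouches inc C σ₂ then
      truncatedWeight inc wFG C - truncatedWeight inc w₁ C else 0)‖ ≤ 2 * (Real.exp (-D) * a σ₁) :=
    kp_norm_sum_ite_both_sub_le ha hd h₁ hFG Λ σ₁ σ₂ hD
  -- the exponents
  set A₁ := ∑ C ∈ Λ.powerset, (if KPTouches inc C σ₁ ∧ ¬ KPTouches inc C σ₂ then
      truncatedWeight inc wF C - truncatedWeight inc w₁ C else 0) with hA₁
  set A₂ := ∑ C ∈ Λ.powerset, (if KPTouches inc C σ₂ ∧ ¬ KPTouches inc C σ₁ then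
      truncatedWeight inc wG C - truncatedWeight inc w₁ C else 0) with hA₂
  set R₁ := ∑ C ∈ Λ.powerset, (if KPTouches inc C σ₁ ∧ KPTouches inc C σ₂ then
      truncatedWeight inc wF C - truncatedWeight inc w₁ C else 0) with hR₁
  set R₂ := ∑ C ∈ Λ.powerset, (if KPTouches inc C σ₁ ∧ KPTouches inc C σ₂ then
      truncatedWeight inc wG C - truncatedWeight inc w₁ C else 0) with hR₂
  set R₁₂ := ∑ C ∈ Λ.powerset, (if KPTouches inc C σ₁ ∧ KPTouches inc C σ₂ then
      truncatedWeight inc wFG C - truncatedWeight inc w₁ C else 0) with hR₁₂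
  have hS₁ : ∑ C ∈ Λ.powerset, (truncatedWeight inc wF C - truncatedWeight inc w₁ C) = A₁ + R₁ := by
    rw [hA₁, hR₁, ← Finset.sum_add_distrib]
    refine Finset.sum_congr rfl fun C _ => ?_
    by_cases h1 : KPTouches inc C σ₁ <;> by_cases h2 : KPTouches inc C σ₂ <;> simp [h1, h2, hv₁]
  have hS₂ : ∑ C ∈ Λ.powerset, (truncatedWeight inc wG C - truncatedWeight inc w₁ C) = A₂ + R₂ := by
    rw [hA₂, hR₂, ← Finset.sum_add_distrib]
    refine Finset.sum_congr rfl fun C _ => ?_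
    by_cases h1 : KPTouches inc C σ₁ <;> by_cases h2 : KPTouches inc C σ₂ <;> simp [h1, h2, hv₂]
  have hS₁₂ : ∑ C ∈ Λ.powerset, (truncatedWeight inc wFG C - truncatedWeight inc w₁ C) =
      A₁ + A₂ + R₁₂ := by
    rw [hA₁, hA₂, hR₁₂, ← Finset.sum_add_distrib, ← Finset.sum_add_distrib]
    refine Finset.sum_congr rfl fun C _ => ?_
    by_cases h1 : KPTouches inc C σ₁ <;> by_cases h2 : KPTouches inc C σ₂
    · simp [h1, h2]
    · simp [h1, h2, hv₁₂₁ C h2]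
    · simp [h1, h2, hv₁₂₂ C h1]
    · simp [h1, h2, hv₁₂₀ C h1 h2]
  -- assemble: `Cov = e^{A₁+A₂} (e^{R₁₂} - e^{R₁+R₂})`
  have hcov : polymerPartitionFunction inc wFG Λ / polymerPartitionFunction inc w₁ Λ -
      (polymerPartitionFunction inc wF Λ / polymerPartitionFunction inc w₁ Λ) *
        (polymerPartitionFunction inc wG Λ / polymerPartitionFunction inc w₁ Λ) =
      Complex.exp (A₁ + A₂) * (Complex.exp R₁₂ - Complex.exp (R₁ + R₂)) := by
    rw [hratio hFG, hratio hF, hratio hG, hS₁, hS₂, hS₁₂, mul_sub, ← Complex.exp_add,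
      ← Complex.exp_add, ← Complex.exp_add]
    congr 2
    all_goals ring
  rw [hcov, norm_mul, Complex.norm_exp]
  -- numeric bounds
  set e : ℝ := Real.exp (-D) * a σ₁ with he
  have hexp1 : Real.exp (-D) ≤ 1 := by rw [Real.exp_le_one_iff]; linarith
  have ha₁ : 0 ≤ a σ₁ := ha σ₁
  have ha₂ : 0 ≤ a σ₂ := ha σ₂
  have he0 : 0 ≤ e := mul_nonneg (Real.exp_nonneg _) ha₁
  have heB : e ≤ a σ₁ := by rw [he]; exact mul_le_of_le_one_left ha₁ hexp1
  have hre : (A₁ + A₂).re ≤ 2 * a σ₁ + 2 * a σ₂ := by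
    have hr := Complex.re_le_norm (A₁ + A₂)
    have hn := norm_add_le A₁ A₂
    linarith
  have hdiff : ‖Complex.exp R₁₂ - Complex.exp (R₁ + R₂)‖ ≤ 6 * e * Real.exp (4 * a σ₁) := by
    have h1 : ‖Complex.exp R₁₂ - 1‖ ≤ 2 * e * Real.exp (4 * a σ₁) := by
      refine (kp_norm_exp_sub_one_le R₁₂).trans ?_
      refine mul_le_mul hR₁₂b (Real.exp_le_exp.2 ?_) (Real.exp_nonneg _)
        (mul_nonneg zero_le_two he0)
      linarith
    have h2 : ‖Complex.exp (R₁ + R₂) - 1‖ ≤ 4 * e * Real.exp (4 * a σ₁) := by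
      refine (kp_norm_exp_sub_one_le (R₁ + R₂)).trans ?_
      have hn : ‖R₁ + R₂‖ ≤ 4 * e := (norm_add_le _ _).trans (by linarith)
      refine mul_le_mul hn (Real.exp_le_exp.2 ?_) (Real.exp_nonneg _) (by linarith)
      linarith
    calc ‖Complex.exp R₁₂ - Complex.exp (R₁ + R₂)‖
        = ‖(Complex.exp R₁₂ - 1) - (Complex.exp (R₁ + R₂) - 1)‖ := by
          rw [sub_sub_sub_cancel_right]
      _ ≤ ‖Complex.exp R₁₂ - 1‖ + ‖Complex.exp (R₁ + R₂) - 1‖ := norm_sub_le _ _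
      _ ≤ 6 * e * Real.exp (4 * a σ₁) := by linarith
  calc Real.exp (A₁ + A₂).re * ‖Complex.exp R₁₂ - Complex.exp (R₁ + R₂)‖
      ≤ Real.exp (2 * a σ₁ + 2 * a σ₂) * (6 * e * Real.exp (4 * a σ₁)) :=
        mul_le_mul (Real.exp_le_exp.2 hre) hdiff (norm_nonneg _) (Real.exp_nonneg _)
    _ = 6 * a σ₁ * Real.exp (6 * a σ₁ + 2 * a σ₂) * Real.exp (-D) := by
        have hexp : Real.exp (6 * a σ₁ + 2 * a σ₂) =
            Real.exp (2 * a σ₁ + 2 * a σ₂) * Real.exp (4 * a σ₁) := by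
          rw [← Real.exp_add]; ring_nf
        rw [hexp, he]; ring

end Summit.QuantumFields.YangMills.Theorems.AnchorGap

end
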